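import Summits.CriticalPhenomena.PercolationContinuityZ3.Theorems.PercNearOneGluingNoHeavyQuantRootReductionMeanLeOne
import Summits.CriticalPhenomena.PercolationContinuityZ3.Theorems.PercNearOneGluingNoHeavyQuantFarTreeRootReduction
import HarnessLib

/-!
# QUANT lane R8, FAR on general trees — `Quant.FarTreeRow` for forests of SUB-UNIT-MEAN trees (unconditional, gate coordinates):
# the tree row holds for every instance in which each tree of the forest has expected reached-relay count `≤ 1`

builds on p205010 (kernel theorem, internal audit signed; external expert review pending)

Support file (`--supports stmt-CriticalPhenomena-4575`), QUANT lane typer seat prim-quant-stmt (gen 17), rung R8 of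
`run/shared/lean/prim/quant/LADDER.md`.  Theorems only, no sorries, standard axioms.  Gate-coordinate corollary of
`Quant.RootDec.rtail_ge_of_mean_le_one` (`…QuantRootReductionMeanLeOne`) through the identification
`Quant.RootDecGate.real_heavy_eq_rtail` (`…QuantFarTreeRootReduction`).

Setting of `Quant.FarTreeRow` / `…QuantFarTreeRootReduction`: independent gates `q : E → [0,1]`, relays `A`, ancestor sets `P a`,
`N(ω) = #{a ∈ A : P a ⊆ ω}`, a labelling `comp : E → κ` constant along ancestry on `A` (e.g. the tree of the forest containing the
gate), `N_k` the count of structure `k`.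
* `Quant.RootDecGate.real_Nk_eq_zero_of_lt`, `sum_real_Nk_eq_one`, `sum_mul_real_Nk_eq` — the law of `N_k` is supported in
  `{0..#fibre}`, has mass `1`, and mean `E N_k = Σ_{a ∈ A, comp a = k} ∏_{y ∈ P a} q y` (linearity of expectation on the finite
  space `Set E`; marginals by `prodBernoulli_real_subset`, Grimmett §1.3).
* `Quant.RootDecGate.farTree_of_mean_le_one` — **`Quant.FarTreeRow`'s hypotheses (`2j < Σ_{a∈A} ∏_{y∈P a} q y`, `1 − ∏_{y∈P a} q y ≤ t`
  on `A`, `0 ≤ t`) plus ONE more — every structure has expected count `Σ_{a ∈ A, comp a = k} ∏_{y∈P a} q y ≤ 1` — give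
  `P(N ≤ j) ≤ t`.**  The trees may have any shape and depth; no forest axiom on `P` is used beyond `comp` being constant along
  ancestry.  (FOR-PAPER2 §7: a kernel FAR family 'forests of light trees'.)

[this work]; product measure / marginals [cite: Grimmett1999, §1.3 p. 10]; the gluing rows served [cite: KozmaNitzan2024, Conjecture 3 (p. 15)].
-/

noncomputable section

namespace Summit.CriticalPhenomena.PercolationContinuityZ3.Theorems

namespace Quant

namespace RootDecGate

open Finset MeasureTheory
open Literature.Probability.LatticeModels
open Literature.Probability.Percolation
open scoped Classical

variable {E : Type*} [Fintype E] {κ : Type} [Fintype κ] [DecidableEq κ]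

/-- configurations of structure counts bounded by `M` (as in `…QuantRootReduction`) -/
local notation3 "cfg[" M "]" => Fintype.piFinset (fun k : κ => Finset.range ((M : κ → ℕ) k + 1))

/-- the ROOT tail (as in `…QuantRootReduction`) -/
local notation3 "RTAIL[" M ", " μ ", " j "]" =>
  ∑ c ∈ cfg[M], (∏ k, (μ : κ → ℕ → ℝ) k ((c : κ → ℕ) k)) * (if (j : ℕ) + 1 ≤ ∑ k, (c : κ → ℕ) k then (1 : ℝ) else 0)

/-- the relays of structure `k` reached in `ω` (as in `…QuantFarTreeRootReduction`) -/
local notation3 "Nk[" A ", " P ", " comp ", " k ", " ω "]" =>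
  (((A : Finset E).filter fun a => (comp : E → κ) a = k).filter fun a => (((P : E → Finset E) a : Finset E) : Set E) ⊆ (ω : Set E)).card

/-! ### 1. The law of a structure count: support, mass, mean -/

omit [Fintype E] [Fintype κ] in
/-- `N_k ≤ #{a ∈ A : comp a = k}`, so `P(N_k = h) = 0` for larger `h`. [this work] -/
theorem real_Nk_eq_zero_of_lt (q : E → unitInterval) (A : Finset E) (P : E → Finset E) (comp : E → κ) (k : κ) (h : ℕ)
    (hh : (A.filter fun a => comp a = k).card < h) :
    (prodBernoulli q).real {ω : Set E | Nk[A, P, comp, k, ω] = h} = 0 := by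
  have hempty : {ω : Set E | Nk[A, P, comp, k, ω] = h} = ∅ := by
    ext ω
    simp only [Set.mem_setOf_eq, Set.mem_empty_iff_false, iff_false]
    exact fun e => (lt_of_le_of_lt (Finset.card_filter_le _ _) hh).ne e
  rw [hempty, measureReal_empty]

/-- A finite probability space: `P(S) = Σ_ω 𝟙[ω ∈ S]·P({ω})` on `Set E`. [folklore] -/
theorem real_eq_sum_singleton (q : E → unitInterval) (S : Set (Set E)) :
    (prodBernoulli q).real S = ∑ ω : Set E, (if ω ∈ S then (prodBernoulli q).real {ω} else 0) := by
  rw [← Finset.sum_filter, sum_measureReal_singleton]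
  congr 1
  ext ω
  simp

omit [Fintype κ] in
/-- The law of `N_k` has total mass `1` on `{0..#fibre}`. [this work] -/
theorem sum_real_Nk_eq_one (q : E → unitInterval) (A : Finset E) (P : E → Finset E) (comp : E → κ) (k : κ) :
    ∑ h ∈ Finset.range ((A.filter fun a => comp a = k).card + 1), (prodBernoulli q).real {ω : Set E | Nk[A, P, comp, k, ω] = h} = 1 := by
  have key := sum_measureReal_preimage_singleton (μ := prodBernoulli q)
    (Finset.range ((A.filter fun a => comp a = k).card + 1)) (f := fun ω : Set E => Nk[A, P, comp, k, ω])
    (fun _ _ => MeasurableSet.of_discrete)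
  have hpre : (fun ω : Set E => Nk[A, P, comp, k, ω]) ⁻¹' (↑(Finset.range ((A.filter fun a => comp a = k).card + 1)) : Set ℕ) =
      Set.univ := by
    ext ω
    simp only [Set.mem_preimage, Finset.coe_range, Set.mem_Iio, Set.mem_univ, iff_true]
    exact Nat.lt_succ_of_le (Finset.card_filter_le _ _)
  rw [hpre, probReal_univ] at key
  rw [← key]
  exact Finset.sum_congr rfl fun h _ => rfl

omit [Fintype κ] in
/-- **Mean of a structure count = sum of the marginals**: `Σ_h h·P(N_k = h) = Σ_{a ∈ A, comp a = k} ∏_{y ∈ P a} q y`. [this work] -/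
theorem sum_mul_real_Nk_eq (q : E → unitInterval) (A : Finset E) (P : E → Finset E) (comp : E → κ) (k : κ) :
    ∑ h ∈ Finset.range ((A.filter fun a => comp a = k).card + 1),
        (h : ℝ) * (prodBernoulli q).real {ω : Set E | Nk[A, P, comp, k, ω] = h} =
      ∑ a ∈ A.filter (fun a => comp a = k), ∏ y ∈ P a, (q y : ℝ) := by
  -- both sides equal `Σ_ω P({ω})·N_k(ω)`
  have hL : ∑ h ∈ Finset.range ((A.filter fun a => comp a = k).card + 1),
      (h : ℝ) * (prodBernoulli q).real {ω : Set E | Nk[A, P, comp, k, ω] = h} =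
      ∑ ω : Set E, (prodBernoulli q).real {ω} * (Nk[A, P, comp, k, ω] : ℝ) := by
    calc ∑ h ∈ Finset.range ((A.filter fun a => comp a = k).card + 1),
          (h : ℝ) * (prodBernoulli q).real {ω : Set E | Nk[A, P, comp, k, ω] = h}
        = ∑ h ∈ Finset.range ((A.filter fun a => comp a = k).card + 1), ∑ ω : Set E,
            (h : ℝ) * (if ω ∈ {ω' : Set E | Nk[A, P, comp, k, ω'] = h} then (prodBernoulli q).real {ω} else 0) := by
          refine Finset.sum_congr rfl fun h _ => ?_
          rw [real_eq_sum_singleton q {ω' : Set E | Nk[A, P, comp, k, ω'] = h}, Finset.mul_sum]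
          refine Finset.sum_congr rfl fun ω _ => ?_
          split_ifs <;> rfl
      _ = ∑ ω : Set E, ∑ h ∈ Finset.range ((A.filter fun a => comp a = k).card + 1),
            (h : ℝ) * (if ω ∈ {ω' : Set E | Nk[A, P, comp, k, ω'] = h} then (prodBernoulli q).real {ω} else 0) :=
          Finset.sum_comm
      _ = ∑ ω : Set E, (prodBernoulli q).real {ω} * (Nk[A, P, comp, k, ω] : ℝ) := by
          refine Finset.sum_congr rfl fun ω _ => ?_
          rw [Finset.sum_eq_single (Nk[A, P, comp, k, ω])]
          · simp only [Set.mem_setOf_eq, if_true, mul_comm]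
          · intro h _ hne
            simp only [Set.mem_setOf_eq]
            rw [if_neg (fun e => hne e.symm), mul_zero]
          · intro hnot
            exact absurd (Finset.mem_range.2 (Nat.lt_succ_of_le (Finset.card_filter_le _ _))) hnot
  have hR : ∑ a ∈ A.filter (fun a => comp a = k), ∏ y ∈ P a, (q y : ℝ) =
      ∑ ω : Set E, (prodBernoulli q).real {ω} * (Nk[A, P, comp, k, ω] : ℝ) := by
    calc ∑ a ∈ A.filter (fun a => comp a = k), ∏ y ∈ P a, (q y : ℝ)
        = ∑ a ∈ A.filter (fun a => comp a = k), ∑ ω : Set E,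
            (if ω ∈ {ω' : Set E | ((P a : Finset E) : Set E) ⊆ ω'} then (prodBernoulli q).real {ω} else 0) := by
          refine Finset.sum_congr rfl fun a _ => ?_
          rw [← prodBernoulli_real_subset q (P a), real_eq_sum_singleton q]
          refine Finset.sum_congr rfl fun ω _ => ?_
          split_ifs <;> rfl
      _ = ∑ ω : Set E, ∑ a ∈ A.filter (fun a => comp a = k),
            (if ω ∈ {ω' : Set E | ((P a : Finset E) : Set E) ⊆ ω'} then (prodBernoulli q).real {ω} else 0) :=
          Finset.sum_comm
      _ = ∑ ω : Set E, (prodBernoulli q).real {ω} * (Nk[A, P, comp, k, ω] : ℝ) := by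
          refine Finset.sum_congr rfl fun ω _ => ?_
          rw [Finset.card_filter, Nat.cast_sum, Finset.mul_sum]
          refine Finset.sum_congr rfl fun a _ => ?_
          simp only [Set.mem_setOf_eq]
          split_ifs <;> simp
  rw [hL, hR]

/-! ### 2. The tree row for forests of sub-unit-mean trees -/

/-- **`Quant.FarTreeRow` for forests of sub-unit-mean trees (unconditional).**  Independent gates `q`, relays `A`, ancestor sets
`P`, a labelling `comp` constant along ancestry on `A`; `0 ≤ t`; every relay has marginal `≥ 1 − t` (`1 − ∏_{y∈P a} q y ≤ t`); every
structure has expected count `Σ_{a ∈ A, comp a = k} ∏_{y∈P a} q y ≤ 1`; budget `2j < Σ_{a∈A} ∏_{y∈P a} q y`.  Then `P(N ≤ j) ≤ t`. [this work] -/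
theorem farTree_of_mean_le_one (q : E → unitInterval) (A : Finset E) (P : E → Finset E) (comp : E → κ)
    (hP : ∀ a ∈ A, ∀ y ∈ P a, comp y = comp a) (j : ℕ) (t : ℝ) (ht : 0 ≤ t)
    (hmarg : ∀ a ∈ A, 1 - ∏ y ∈ P a, (q y : ℝ) ≤ t)
    (hmean : ∀ k, ∑ a ∈ A.filter (fun a => comp a = k), ∏ y ∈ P a, (q y : ℝ) ≤ 1)
    (hbudget : (2 * j : ℝ) < ∑ a ∈ A, ∏ y ∈ P a, (q y : ℝ)) :
    (prodBernoulli q).real {ω : Set E | (A.filter fun a => ((P a : Finset E) : Set E) ⊆ ω).card ≤ j} ≤ t := by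
  have key := RootDec.rtail_ge_of_mean_le_one (fun k => (A.filter fun a => comp a = k).card) A.card
    (fun k => Finset.card_filter_le _ _) (fun k h => (prodBernoulli q).real {ω : Set E | Nk[A, P, comp, k, ω] = h})
    (fun k h => measureReal_nonneg) (fun k h hh => real_Nk_eq_zero_of_lt q A P comp k h hh)
    (fun k => sum_real_Nk_eq_one q A P comp k)
    (fun k => ∑ a ∈ A.filter (fun a => comp a = k), ∏ y ∈ P a, (q y : ℝ)) (fun k => (sum_mul_real_Nk_eq q A P comp k).symm)
    hmean (1 - t) (by linarith) ?_ j ?_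
  · rw [← real_heavy_eq_rtail q A P comp hP j] at key
    rw [real_light_eq_one_sub]
    linarith
  · -- the floor: each of the `#fibre` marginals is `≥ 1 − t`
    intro k
    have h := Finset.card_nsmul_le_sum (A.filter fun a => comp a = k) (fun a => ∏ y ∈ P a, (q y : ℝ)) (1 - t)
      (fun a ha => by linarith [hmarg a (Finset.mem_filter.1 ha).1])
    rw [nsmul_eq_mul] at h
    linarith
  · -- the budget, fibrewise
    rw [← Finset.sum_fiberwise_of_maps_to (s := A) (t := Finset.univ) (g := comp) (fun a _ => Finset.mem_univ _)
      (f := fun a => ∏ y ∈ P a, (q y : ℝ))] at hbudget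
    exact hbudget

end RootDecGate

end Quant

end Summit.CriticalPhenomena.PercolationContinuityZ3.Theorems
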